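import Mathlib
import Summits.AtomisticToContinuum.HydrodynamicLimit.Theorems.ImplosionDichotomyDenseExcursionPackingAnalyticSonicTriangle
import Summits.AtomisticToContinuum.HydrodynamicLimit.Theorems.ImplosionDichotomyDenseExcursionPackingAnalyticSonicProfile
import Summits.AtomisticToContinuum.HydrodynamicLimit.Theorems.ImplosionDichotomyDenseExcursionPackingAnalyticSonicRayEstimates

/-!
# The `k`-uniform sup-norm A-PRIORI BOUND on the complex sonic triangle for the order-`k` packing problem
# (crux `DenseExcursion`, stmt-AtomisticToContinuum-12586, line `sonic-cavity-renewal` v9, stub `stub_analyticPackingImplosion`)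

Helper file (`--supports stmt-AtomisticToContinuum-12586`, line lead a2, wave-5 worker D2, task `sonicWindow_analytic_bound`,
worker reports `work/stubs/D1_gammaClosure.REPORT.md` §3.2(ii) and `D2_triangle.REPORT.md`). THE LINEAR WINDOW ESTIMATE with
no `e^{ck}`: for `Λ ≥ Λ₀`, `ρ ≤ ρ₀` and ANY bounded holomorphic pair `(U₁, U₂)` on the sonic triangle
`𝒟_ρ = {−3ρ < Re z < ρ, |Im z| < (Re z + 3ρ)/2}` whose complexified resolvent residual
`Λ U − L_ℂ U` (coefficients = the holomorphic extension `(Wc, Sc)` of the profile) is bounded by `N` on `𝒟_ρ` and whose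
trace on the real window `(−3ρ, ρ)` is bounded by `R`,
`‖U₁ z‖ + ‖U₂ z‖ ≤ 168 (R + N/Λ)` on `𝒟_ρ` (`sonicTriangle_apriori_bound`, REGISTERED helper).

Proof (characteristic variables `P = U₁ + 3U₂`, `M = U₁ − 3U₂`): `c₋ M′ = (Λ − b₋₋)M − b₋₊P − F₋` is transported along the
slanted segment from the REAL foot `p(z) = Re z − 2|Im z|` with damping `Re ≥ Λ|Im z|/5 − O(1)` (the profile package gives
`Re c₋ ≤ −1`, `|Im c₋| ≤ 1/5`, `‖c₋‖ ≤ 3`), so `sup‖M‖ ≤ 3R + 30(C_β sup‖P‖ + 4N)/Λ` (`rayTransport_weighted_bound`, `K = 0`);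
`z P′ + (Λ/κ) P = H` with `‖H‖ ≤ (6ρΛC_e/κ²) sup‖P‖ + (2/κ)(C_β sup‖P‖ + C_β sup‖M‖ + 4N)` (`c₊ = z d`, `Λ/κ + Λ/d = Λ z e/(κ d)`),
so `sup‖P‖ ≤ (1/4 + 1/25) sup‖P‖ + (2C_β/Λ) sup‖M‖ + 8N/Λ` (`eulerHolomorphic_apriori_bound`); the `2 × 2` system of sup
inequalities closes for `Λ ≥ 50 C_β`, `ρ ≤ κ/(24(C_e + 1))`.

Sources: standard (method of characteristics in the complex domain; Nirenberg 1972). NOT here: existence of the holomorphic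
extension, the identification with the real solution, or `Γ`.
-/

noncomputable section

open Set Metric Filter Topology

namespace Summit.AtomisticToContinuum.HydrodynamicLimit.Theorems.PackingAnalyticImplosion

open Summit.AtomisticToContinuum.HydrodynamicLimit.Theorems.R2OneModeTwoConditions
open Summit.AtomisticToContinuum.HydrodynamicLimit.Theorems.SonicCavityRenewal

/-- Norm of a scalar multiple bounded by bounds of the factors. [folklore] -/
theorem norm_mul_le_of_le {c x : ℂ} {a b : ℝ} (hc : ‖c‖ ≤ a) (hx : ‖x‖ ≤ b) (ha : 0 ≤ a) : ‖c * x‖ ≤ a * b := by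
  rw [norm_mul]; exact mul_le_mul hc hx (norm_nonneg _) ha

/-- The four characteristic coefficients `b±±`, `b±∓` are bounded by `9 Cb + 2` when `‖W‖, ‖W′‖, ‖S‖, ‖S′‖ ≤ Cb` and
`|r| ≤ 2`. [folklore] -/
theorem norm_charCoeff_le {W W' S S' : ℂ} {r Cb : ℝ} (hCb : 0 ≤ Cb) (hW : ‖W‖ ≤ Cb) (hW' : ‖W'‖ ≤ Cb) (hS : ‖S‖ ≤ Cb)
    (hS' : ‖S'‖ ≤ Cb) (hr : |r| ≤ 2) :
    ‖2 / 3 * W' + 2 * W - (r : ℂ) + 2 * S' + 4 * S‖ ≤ 9 * Cb + 2 ∧ ‖W' / 3 + S' + 2 * S‖ ≤ 9 * Cb + 2 ∧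
      ‖2 / 3 * W' + 2 * W - (r : ℂ) - 2 * S' - 4 * S‖ ≤ 9 * Cb + 2 ∧ ‖W' / 3 - S' - 2 * S‖ ≤ 9 * Cb + 2 := by
  have hr' : ‖(r : ℂ)‖ ≤ 2 := by rw [Complex.norm_real, Real.norm_eq_abs]; exact hr
  have h23 : ‖(2 / 3 : ℂ) * W'‖ ≤ 2 / 3 * Cb := norm_mul_le_of_le (by norm_num) hW' (by norm_num)
  have h2W : ‖(2 : ℂ) * W‖ ≤ 2 * Cb := norm_mul_le_of_le (by norm_num) hW (by norm_num)
  have h2S' : ‖(2 : ℂ) * S'‖ ≤ 2 * Cb := norm_mul_le_of_le (by norm_num) hS' (by norm_num)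
  have h4S : ‖(4 : ℂ) * S‖ ≤ 4 * Cb := norm_mul_le_of_le (by norm_num) hS (by norm_num); have h2S : ‖(2 : ℂ) * S‖ ≤ 2 * Cb := norm_mul_le_of_le (by norm_num) hS (by norm_num)
  have hW3 : ‖W' / 3‖ ≤ Cb / 3 := by rw [norm_div]; norm_num; linarith
  refine ⟨?_, ?_, ?_, ?_⟩
  · calc ‖2 / 3 * W' + 2 * W - (r : ℂ) + 2 * S' + 4 * S‖
          ≤ ‖2 / 3 * W'‖ + ‖2 * W‖ + ‖(r : ℂ)‖ + ‖2 * S'‖ + ‖4 * S‖ :=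
            norm_add_le_of_le (norm_add_le_of_le (norm_sub_le_of_le (norm_add_le _ _) le_rfl) le_rfl) le_rfl
      _ ≤ 9 * Cb + 2 := by linarith
  · calc ‖W' / 3 + S' + 2 * S‖ ≤ ‖W' / 3‖ + ‖S'‖ + ‖2 * S‖ := norm_add_le_of_le (norm_add_le _ _) le_rfl
      _ ≤ 9 * Cb + 2 := by linarith
  · calc ‖2 / 3 * W' + 2 * W - (r : ℂ) - 2 * S' - 4 * S‖
          ≤ ‖2 / 3 * W'‖ + ‖2 * W‖ + ‖(r : ℂ)‖ + ‖2 * S'‖ + ‖4 * S‖ :=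
            norm_sub_le_of_le (norm_sub_le_of_le (norm_sub_le_of_le (norm_add_le _ _) le_rfl) le_rfl) le_rfl
      _ ≤ 9 * Cb + 2 := by linarith
  · calc ‖W' / 3 - S' - 2 * S‖ ≤ ‖W' / 3‖ + ‖S'‖ + ‖2 * S‖ := norm_sub_le_of_le (norm_sub_le _ _) le_rfl
      _ ≤ 9 * Cb + 2 := by linarith

/-- The damping of the regular characteristic along a slanted ray of slope `1/2`: for `c = c₋(ξ)` with `Re c ≤ −1`,
`|Im c| ≤ 1/5`, `‖c‖ ≤ 3` and the ray direction `v = 2|y| + i y`, `Re(−v/c) ≥ |y|/5`. [folklore] -/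
theorem ray_damping_re {c : ℂ} {y : ℝ} (hre : c.re ≤ -1) (him : |c.im| ≤ 1 / 5) (hn : ‖c‖ ≤ 3) :
    |y| / 5 ≤ (-(((2 * |y| : ℝ) : ℂ) + (y : ℂ) * Complex.I) / c).re := by
  have hc0 : c ≠ 0 := fun h => by rw [h] at hre; norm_num at hre
  have hns : 0 < Complex.normSq c := Complex.normSq_pos.2 hc0
  have hns9 : Complex.normSq c ≤ 9 := by
    rw [Complex.normSq_eq_norm_sq]; nlinarith [norm_nonneg c]
  have hvre : (-(((2 * |y| : ℝ) : ℂ) + (y : ℂ) * Complex.I)).re = -(2 * |y|) := by simp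
  have hvim : (-(((2 * |y| : ℝ) : ℂ) + (y : ℂ) * Complex.I)).im = -y := (by simp); rw [Complex.div_re, hvre, hvim]
  have hnum : 9 / 5 * |y| ≤ -(2 * |y|) * c.re + -y * c.im := by
    have h1 : 2 * |y| ≤ -(2 * |y|) * c.re := by nlinarith [abs_nonneg y]
    have h2 : -(|y| / 5) ≤ -y * c.im := by
      have : |y * c.im| ≤ |y| * (1 / 5) := by rw [abs_mul]; exact mul_le_mul_of_nonneg_left him (abs_nonneg y)
      have := (abs_le.1 this).2
      linarith
    linarith
  have hy0 : 0 ≤ |y| := abs_nonneg y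
  rw [← add_div]
  calc |y| / 5 = 9 / 5 * |y| / 9 := by ring
    _ ≤ (-(2 * |y|) * c.re + -y * c.im) / 9 := by gcongr
    _ ≤ (-(2 * |y|) * c.re + -y * c.im) / Complex.normSq c :=
        div_le_div_of_nonneg_left (by linarith) hns hns9

set_option maxHeartbeats 1600000 in -- one declaration: the whole 2×2 a-priori estimate (transport + Euler + absorption)
/-- **THE SUP-NORM A-PRIORI BOUND ON THE SONIC TRIANGLE** (registered helper `sonicTriangle_apriori_bound` of
`stub_analyticPackingImplosion`): for `Λ ≥ Λ₀`, `0 < ρ ≤ ρ₀` and any bounded holomorphic pair on `𝒟_ρ` with complexified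
resolvent residual `≤ N` on `𝒟_ρ` and real-window trace `≤ R`: `‖U₁ z‖ + ‖U₂ z‖ ≤ C (R + N/Λ)` on `𝒟_ρ`, with `ρ₀, Λ₀, C`
depending only on the profile. [folklore] -/
theorem sonicTriangle_apriori_bound : ∀ (r : ℝ) (W S : ℝ → ℝ) (Wc Sc : ℂ → ℂ), IsMonatomicProfile r W S → CavityTube r W S → AnalyticOnNhd ℂ Wc (Metric.ball 0 (1 / 10)) → AnalyticOnNhd ℂ Sc (Metric.ball 0 (1 / 10)) → (∀ x : ℝ, |x| < 1 / 10 → Wc (x : ℂ) = ((W x : ℝ) : ℂ) ∧ Sc (x : ℂ) = ((S x : ℝ) : ℂ) ∧ deriv Wc (x : ℂ) = ((deriv W x : ℝ) : ℂ) ∧ deriv Sc (x : ℂ) = ((deriv S x : ℝ) : ℂ)) → ∃ (ρ₀ Λ₀ C : ℝ), 0 < ρ₀ ∧ 0 < Λ₀ ∧ 0 < C ∧ ∀ (Λ ρ : ℝ), Λ₀ ≤ Λ → 0 < ρ → ρ ≤ ρ₀ → ∀ (U₁ U₂ : ℂ → ℂ) (N R : ℝ), DifferentiableOn ℂ U₁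 {z : ℂ | -(3 * ρ) < z.re ∧ z.re < ρ ∧ |z.im| < (z.re + 3 * ρ) / 2} → DifferentiableOn ℂ U₂ {z : ℂ | -(3 * ρ) < z.re ∧ z.re < ρ ∧ |z.im| < (z.re + 3 * ρ) / 2} → (∃ K : ℝ, ∀ z ∈ {z : ℂ | -(3 * ρ) < z.re ∧ z.re < ρ ∧ |z.im| < (z.re + 3 * ρ) / 2}, ‖U₁ z‖ ≤ K ∧ ‖U₂ z‖ ≤ K) → (∀ z ∈ {z : ℂ | -(3 * ρ) < z.re ∧ z.re < ρ ∧ |z.im| < (z.re + 3 * ρ) / 2}, ‖(Λ : ℂ) * U₁ z - ((Wc z - 1) * deriv U₁ z + 3 * Sc z * deriv U₂ z + (deriv Wc z + 2 * Wc z - r) * U₁ z + (3 * deriv Sc z + 6 * Sc z) * U₂ z)‖ ≤ N ∧ ‖(Λ : ℂ) * U₂ z - (Sc z / 3 * deriv U₁ z + (Wc z - 1) * deriv U₂ z + (deriv Sc z + 2 * Sc z) * U₁ z + (deriv Wc z / 3 + 2 * Wc z - r) * U₂ z)‖ ≤ N) → (∀ x : ℝ, -(3 * ρ) < x → x < ρ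 → ‖U₁ (x : ℂ)‖ + ‖U₂ (x : ℂ)‖ ≤ R) → ∀ z ∈ {z : ℂ | -(3 * ρ) < z.re ∧ z.re < ρ ∧ |z.im| < (z.re + 3 * ρ) / 2}, ‖U₁ z‖ + ‖U₂ z‖ ≤ C * (R + N / Λ) := by
  intro r W S Wc Sc hprof htube hWc hSc hext
  obtain ⟨R₀, κ, Cb, Ce, d, e, hR₀, hR₀le, hκ, hCb, hCe, hdd, hed, hfac, hd0, hbnd⟩ :=
    sonicTriangle_profile r W S Wc Sc hprof htube hWc hSc hext
  have hr1 : 1 < r := hprof.1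
  have hr2 : r < 2 := by
    have h3 : (1 : ℝ) < Real.sqrt 3 := by
      rw [show (1 : ℝ) = Real.sqrt 1 by simp]; exact Real.sqrt_lt_sqrt (by norm_num) (by norm_num)
    linarith [hprof.2.1]
  have hrabs : |r| ≤ 2 := by rw [abs_of_pos (by linarith)]; exact hr2.le
  have hκ0 : 0 < κ := by linarith
  -- the constants
  set Cβ : ℝ := 9 * Cb + 2 with hCβ
  have hCβ2 : 2 ≤ Cβ := by simp only [hCβ]; linarith
  refine ⟨min (R₀ / 3) (κ / (24 * (Ce + 1))), 50 * Cβ, 168, lt_min (by linarith) (by positivity), by linarith,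
    by norm_num, ?_⟩
  intro Λ ρ hΛ hρ hρ₀ U₁ U₂ N R hU₁ hU₂ hK hres hreal
  obtain ⟨K, hK⟩ := hK
  have hΛ0 : 0 < Λ := by linarith
  have hρR : 3 * ρ ≤ R₀ := by linarith [min_le_left (R₀ / 3) (κ / (24 * (Ce + 1)))]
  have hρκ : ρ ≤ κ / (24 * (Ce + 1)) := hρ₀.trans (min_le_right _ _)
  -- the triangle
  set D : Set ℂ := {z : ℂ | -(3 * ρ) < z.re ∧ z.re < ρ ∧ |z.im| < (z.re + 3 * ρ) / 2} with hD
  have hDo : IsOpen D := isOpen_sonicTriangle ρ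
  have h0D : (0 : ℂ) ∈ D := zero_mem_sonicTriangle hρ
  have hDst : StarConvex ℝ (0 : ℂ) D := starConvex_sonicTriangle h0D
  have hDball : ∀ w ∈ D, w ∈ ball (0 : ℂ) R₀ := fun w hw => by
    rw [mem_ball, dist_zero_right]; exact (norm_lt_of_mem_sonicTriangle hw).trans_le hρR
  have hDball' : ∀ w ∈ D, w ∈ ball (0 : ℂ) (1 / 10) := fun w hw => ball_subset_ball hR₀le (hDball w hw)
  have hnormD : ∀ w ∈ D, ‖w‖ ≤ 3 * ρ := fun w hw => (norm_lt_of_mem_sonicTriangle hw).le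
  -- nonnegativity of the data
  have hR0 : 0 ≤ R := le_trans (by positivity) (hreal 0 (by linarith) hρ)
  have hN0 : 0 ≤ N := le_trans (norm_nonneg _) (hres 0 h0D).1
  -- characteristic variables and residuals
  set P : ℂ → ℂ := fun z => U₁ z + 3 * U₂ z with hP
  set M : ℂ → ℂ := fun z => U₁ z - 3 * U₂ z with hM
  set f₁ : ℂ → ℂ := fun z => (Λ : ℂ) * U₁ z - ((Wc z - 1) * deriv U₁ z + 3 * Sc z * deriv U₂ z +
    (deriv Wc z + 2 * Wc z - r) * U₁ z + (3 * deriv Sc z + 6 * Sc z) * U₂ z) with hf₁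
  set f₂ : ℂ → ℂ := fun z => (Λ : ℂ) * U₂ z - (Sc z / 3 * deriv U₁ z + (Wc z - 1) * deriv U₂ z +
    (deriv Sc z + 2 * Sc z) * U₁ z + (deriv Wc z / 3 + 2 * Wc z - r) * U₂ z) with hf₂
  set bpp : ℂ → ℂ := fun z => 2 / 3 * deriv Wc z + 2 * Wc z - (r : ℂ) + 2 * deriv Sc z + 4 * Sc z with hbpp
  set bpm : ℂ → ℂ := fun z => deriv Wc z / 3 + deriv Sc z + 2 * Sc z with hbpm
  set bmm : ℂ → ℂ := fun z => 2 / 3 * deriv Wc z + 2 * Wc z - (r : ℂ) - 2 * deriv Sc z - 4 * Sc z with hbmm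
  set bmp : ℂ → ℂ := fun z => deriv Wc z / 3 - deriv Sc z - 2 * Sc z with hbmp
  set cm : ℂ → ℂ := fun z => Wc z - 1 - Sc z with hcm
  have hresN : ∀ w ∈ D, ‖f₁ w‖ ≤ N ∧ ‖f₂ w‖ ≤ N := fun w hw => hres w hw
  -- holomorphy and derivatives
  have hU₁d : ∀ w ∈ D, HasDerivAt U₁ (deriv U₁ w) w := fun w hw => (hU₁.differentiableAt (hDo.mem_nhds hw)).hasDerivAt
  have hU₂d : ∀ w ∈ D, HasDerivAt U₂ (deriv U₂ w) w := fun w hw => (hU₂.differentiableAt (hDo.mem_nhds hw)).hasDerivAt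
  have hPd : ∀ w ∈ D, HasDerivAt P (deriv U₁ w + 3 * deriv U₂ w) w := fun w hw => (hU₁d w hw).fun_add ((hU₂d w hw).const_mul 3)
  have hMd : ∀ w ∈ D, HasDerivAt M (deriv U₁ w - 3 * deriv U₂ w) w := fun w hw => (hU₁d w hw).fun_sub ((hU₂d w hw).const_mul 3)
  have hPdiff : DifferentiableOn ℂ P D := fun w hw => (hPd w hw).differentiableAt.differentiableWithinAt
  -- the characteristic identities (pure algebra)
  have hcharP : ∀ w, (Wc w - 1 + Sc w) * (deriv U₁ w + 3 * deriv U₂ w) =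
      ((Λ : ℂ) - bpp w) * P w - bpm w * M w - (f₁ w + 3 * f₂ w) := by
    intro w; simp only [hP, hM, hf₁, hf₂, hbpp, hbpm]; ring
  have hcharM : ∀ w, cm w * (deriv U₁ w - 3 * deriv U₂ w) =
      ((Λ : ℂ) - bmm w) * M w - bmp w * P w - (f₁ w - 3 * f₂ w) := by
    intro w; simp only [hP, hM, hf₁, hf₂, hbmm, hbmp, hcm]; ring
  -- coefficient bounds on the disc
  have hcoef : ∀ w ∈ D, ‖bpp w‖ ≤ Cβ ∧ ‖bpm w‖ ≤ Cβ ∧ ‖bmm w‖ ≤ Cβ ∧ ‖bmp w‖ ≤ Cβ ∧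
      (cm w).re ≤ -1 ∧ |(cm w).im| ≤ 1 / 5 ∧ ‖cm w‖ ≤ 3 ∧ (d w).re ≤ -(κ / 2) ∧ ‖d w‖ ≤ 2 * κ ∧ ‖e w‖ ≤ Ce := by
    intro w hw
    obtain ⟨h1, h2, h3, h4, h5, h6, h7, h8, h9, h10⟩ := hbnd w (hDball w hw)
    obtain ⟨b1, b2, b3, b4⟩ := norm_charCoeff_le hCb h7 h8 h9 h10 hrabs
    exact ⟨b1, b2, b3, b4, h4, h5, h6, h1, h2, h3⟩
  have hcm_ne : ∀ w ∈ D, cm w ≠ 0 := fun w hw h => by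
    have := (hcoef w hw).2.2.2.2.1; rw [h] at this; norm_num at this
  have hcm_norm : ∀ w ∈ D, 1 ≤ ‖cm w‖ := fun w hw => by
    have h1 := (hcoef w hw).2.2.2.2.1; have h2 := Complex.abs_re_le_norm (cm w)
    have h3 : 1 ≤ |(cm w).re| := (by rw [abs_of_nonpos (by linarith)]; linarith); linarith
  have hd_ne : ∀ w ∈ D, d w ≠ 0 := fun w hw h => by
    have := (hcoef w hw).2.2.2.2.2.2.2.1; rw [h] at this; norm_num at this; linarith
  have hd_norm : ∀ w ∈ D, κ / 2 ≤ ‖d w‖ := fun w hw => by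
    have h1 := (hcoef w hw).2.2.2.2.2.2.2.1; have h2 := Complex.abs_re_le_norm (d w)
    have h3 : κ / 2 ≤ |(d w).re| := (by rw [abs_of_nonpos (by linarith)]; linarith); linarith
  -- the sups
  have hPK : ∀ w ∈ D, ‖P w‖ ≤ 4 * K := fun w hw => by
    have := hK w hw
    calc ‖P w‖ ≤ ‖U₁ w‖ + ‖(3 : ℂ) * U₂ w‖ := norm_add_le _ _
      _ ≤ 4 * K := by rw [norm_mul]; norm_num; linarith
  have hMK : ∀ w ∈ D, ‖M w‖ ≤ 4 * K := fun w hw => by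
    have := hK w hw
    calc ‖M w‖ ≤ ‖U₁ w‖ + ‖(3 : ℂ) * U₂ w‖ := norm_sub_le _ _
      _ ≤ 4 * K := by rw [norm_mul]; norm_num; linarith
  set SP : ℝ := sSup ((fun w => ‖P w‖) '' D) with hSP
  set SM : ℝ := sSup ((fun w => ‖M w‖) '' D) with hSM
  have hSPb : BddAbove ((fun w => ‖P w‖) '' D) := ⟨4 * K, by rintro _ ⟨w, hw, rfl⟩; exact hPK w hw⟩
  have hSMb : BddAbove ((fun w => ‖M w‖) '' D) := ⟨4 * K, by rintro _ ⟨w, hw, rfl⟩; exact hMK w hw⟩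
  have hneP : ((fun w => ‖P w‖) '' D).Nonempty := ⟨_, ⟨0, h0D, rfl⟩⟩; have hneM : ((fun w => ‖M w‖) '' D).Nonempty := ⟨_, ⟨0, h0D, rfl⟩⟩
  have hP_le : ∀ w ∈ D, ‖P w‖ ≤ SP := fun w hw => le_csSup hSPb ⟨w, hw, rfl⟩
  have hM_le : ∀ w ∈ D, ‖M w‖ ≤ SM := fun w hw => le_csSup hSMb ⟨w, hw, rfl⟩
  have hSP0 : 0 ≤ SP := (norm_nonneg _).trans (hP_le 0 h0D); have hSM0 : 0 ≤ SM := (norm_nonneg _).trans (hM_le 0 h0D)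
  -- real-trace bounds for `P`, `M`
  have hMreal : ∀ x : ℝ, -(3 * ρ) < x → x < ρ → ‖M (x : ℂ)‖ ≤ 3 * R := by
    intro x h1 h2
    have h := hreal x h1 h2
    have hn1 : 0 ≤ ‖U₁ (x : ℂ)‖ := norm_nonneg _
    calc ‖M (x : ℂ)‖ ≤ ‖U₁ (x : ℂ)‖ + ‖(3 : ℂ) * U₂ (x : ℂ)‖ := norm_sub_le _ _
      _ ≤ 3 * R := by rw [norm_mul]; norm_num; linarith
  -- STEP 1: transport bound for `M`
  have hMbound : ∀ z ∈ D, ‖M z‖ ≤ 3 * R + 30 * (Cβ * SP + 4 * N) / Λ := by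
    intro z hz
    have hextra : 0 ≤ 30 * (Cβ * SP + 4 * N) / Λ := by positivity
    by_cases hy : z.im = 0
    · have hzr : z = ((z.re : ℝ) : ℂ) := Complex.ext (by simp) (by simp [hy])
      have h := hMreal z.re hz.1 hz.2.1
      rw [← hzr] at h
      linarith
    · -- the slanted segment from the real foot
      have hy0 : 0 < |z.im| := abs_pos.2 hy
      set p : ℂ := ((z.re - 2 * |z.im| : ℝ) : ℂ) with hp
      set v : ℂ := z - p with hv
      obtain ⟨hp1, hp2, -⟩ := rayFoot_mem_window hz
      have hvn := norm_sub_rayFoot (z := z)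
      rw [← hp, ← hv] at hvn
      have hv3 : ‖v‖ ≤ 3 * |z.im| := by nlinarith [hvn.1, norm_nonneg v, abs_nonneg z.im, sq_abs z.im]
      have hv2 : 2 * |z.im| ≤ ‖v‖ := hvn.2
      have hvre : v = ((2 * |z.im| : ℝ) : ℂ) + (z.im : ℂ) * Complex.I := by
        apply Complex.ext <;> simp [hv, hp]
      have hseg : ∀ t ∈ Icc (0 : ℝ) 1, p + (t : ℂ) * v ∈ D := fun t ht => ray_mem_sonicTriangle hz ht
      set g : ℂ → ℂ := fun w => ((Λ : ℂ) - bmm w) / cm w with hg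
      set F : ℂ → ℂ := fun w => -(bmp w * P w + (f₁ w - 3 * f₂ w)) / cm w with hF
      set β₀ : ℝ := |z.im| * Λ / 10 with hβ₀
      have hβ₀pos : 0 < β₀ := by positivity
      -- (i) the equation along the segment
      have hderiv : ∀ t ∈ Icc (0 : ℝ) 1,
          HasDerivAt M (g (p + (t : ℂ) * v) * M (p + (t : ℂ) * v) + F (p + (t : ℂ) * v)) (p + (t : ℂ) * v) := by
        intro t ht
        have hw := hseg t ht
        refine (hMd _ hw).congr_deriv ?_
        have hc := hcm_ne _ hw
        have hid := hcharM (p + (t : ℂ) * v)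
        simp only [hg, hF]
        field_simp
        linear_combination hid
      -- (ii) the damping
      have hdamp : ∀ t ∈ Icc (0 : ℝ) 1, β₀ ≤ 0 * ‖v‖ + (-(v * g (p + (t : ℂ) * v))).re := by
        intro t ht
        have hw := hseg t ht
        obtain ⟨-, -, hbmm_le, -, hcre, hcim, hcn, -⟩ := hcoef _ hw
        have hc := hcm_ne _ hw
        have hsplit : -(v * g (p + (t : ℂ) * v)) =
            (Λ : ℂ) * (-v / cm (p + (t : ℂ) * v)) + v * bmm (p + (t : ℂ) * v) / cm (p + (t : ℂ) * v) := by
          simp only [hg]; field_simp; ring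
        have hmain : |z.im| / 5 ≤ (-v / cm (p + (t : ℂ) * v)).re := by
          have h := ray_damping_re (y := z.im) hcre hcim hcn
          rwa [← hvre] at h
        have hpert : |(v * bmm (p + (t : ℂ) * v) / cm (p + (t : ℂ) * v)).re| ≤ 3 * |z.im| * Cβ := by
          refine (Complex.abs_re_le_norm _).trans ?_
          rw [norm_div, norm_mul]
          calc ‖v‖ * ‖bmm (p + (t : ℂ) * v)‖ / ‖cm (p + (t : ℂ) * v)‖ ≤ ‖v‖ * ‖bmm (p + (t : ℂ) * v)‖ / 1 :=
                div_le_div_of_nonneg_left (by positivity) one_pos (hcm_norm _ hw)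
            _ ≤ 3 * |z.im| * Cβ := by
                rw [div_one]; exact mul_le_mul hv3 hbmm_le (norm_nonneg _) (by positivity)
        have hΛre : ((Λ : ℂ) * (-v / cm (p + (t : ℂ) * v))).re = Λ * (-v / cm (p + (t : ℂ) * v)).re := by
          simp [Complex.mul_re]
        rw [hsplit, Complex.add_re, hΛre, zero_mul, zero_add]
        have h1 : Λ * (|z.im| / 5) ≤ Λ * (-v / cm (p + (t : ℂ) * v)).re := mul_le_mul_of_nonneg_left hmain hΛ0.le
        have h2 := (abs_le.1 hpert).1
        have h3 : 30 * Cβ * |z.im| ≤ Λ * |z.im| := mul_le_mul_of_nonneg_right (by linarith) hy0.le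
        simp only [hβ₀]
        nlinarith
      -- (iii) the forcing
      have hforce : ∀ t ∈ Icc (0 : ℝ) 1, Real.exp (-(0 * t * ‖v‖)) * ‖F (p + (t : ℂ) * v)‖ ≤ Cβ * SP + 4 * N := by
        intro t ht
        have hw := hseg t ht
        rw [zero_mul, zero_mul, neg_zero, Real.exp_zero, one_mul]
        obtain ⟨-, -, -, hbmp_le, -⟩ := hcoef _ hw
        obtain ⟨hf1, hf2⟩ := hresN _ hw
        simp only [hF]
        rw [norm_div, norm_neg]
        calc ‖bmp (p + (t : ℂ) * v) * P (p + (t : ℂ) * v) + (f₁ (p + (t : ℂ) * v) - 3 * f₂ (p + (t : ℂ) * v))‖ /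
              ‖cm (p + (t : ℂ) * v)‖
            ≤ ‖bmp (p + (t : ℂ) * v) * P (p + (t : ℂ) * v) + (f₁ (p + (t : ℂ) * v) - 3 * f₂ (p + (t : ℂ) * v))‖ / 1 :=
              div_le_div_of_nonneg_left (norm_nonneg _) one_pos (hcm_norm _ hw)
          _ ≤ Cβ * SP + 4 * N := by
              rw [div_one]
              refine norm_add_le_of_le (norm_mul_le_of_le hbmp_le (hP_le _ hw) (by linarith)) ?_
              calc ‖f₁ (p + (t : ℂ) * v) - 3 * f₂ (p + (t : ℂ) * v)‖
                  ≤ ‖f₁ (p + (t : ℂ) * v)‖ + ‖(3 : ℂ) * f₂ (p + (t : ℂ) * v)‖ := norm_sub_le _ _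
                _ ≤ 4 * N := by rw [norm_mul]; norm_num; linarith
      have key := rayTransport_weighted_bound g F M p v 0 β₀ (Cβ * SP + 4 * N) hβ₀pos hderiv hdamp hforce
      rw [zero_mul, neg_zero, Real.exp_zero, one_mul] at key
      have hpv : p + v = z := by simp only [hv]; ring
      rw [hpv] at key
      have hMp : ‖M p‖ ≤ 3 * R := hMreal _ hp1 hp2
      have hexp : Real.exp (-β₀) ≤ 1 := Real.exp_le_one_iff.2 (by linarith)
      have hlast : ‖v‖ * (Cβ * SP + 4 * N) / β₀ ≤ 30 * (Cβ * SP + 4 * N) / Λ := by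
        simp only [hβ₀]
        rw [div_le_div_iff₀ (by positivity) hΛ0]
        have hΦ0 : 0 ≤ Cβ * SP + 4 * N := by positivity
        nlinarith [mul_le_mul_of_nonneg_right hv3 (mul_nonneg hΦ0 hΛ0.le)]
      have hMp0 : 0 ≤ ‖M p‖ := norm_nonneg _
      nlinarith [mul_le_mul hMp hexp (Real.exp_pos _).le (by linarith)]
  have hSMle : SM ≤ 3 * R + 30 * (Cβ * SP + 4 * N) / Λ :=
    csSup_le hneM (by rintro _ ⟨w, hw, rfl⟩; exact hMbound w hw)
  -- STEP 2: Euler bound for `P`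
  set a₀ : ℝ := Λ / κ with ha₀
  have ha₀pos : 0 < a₀ := div_pos hΛ0 hκ0
  set H : ℂ → ℂ := fun w => (a₀ : ℂ) * P w + (((Λ : ℂ) - bpp w) * P w - bpm w * M w - (f₁ w + 3 * f₂ w)) / d w with hH
  have hPeq : ∀ w ∈ D, w * deriv P w + a₀ * P w = H w := by
    intro w hw
    rw [(hPd w hw).deriv]
    have hid := hcharP w
    rw [(hfac w (hDball' w hw)).1] at hid
    have hdw := hd_ne w hw
    simp only [hH]
    field_simp
    linear_combination hid
  have hHbound : ∀ w ∈ D, ‖H w‖ ≤ 6 * ρ * Λ * Ce / κ ^ 2 * SP + 2 / κ * (Cβ * SP + Cβ * SM + 4 * N) := by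
    intro w hw
    obtain ⟨hbpp_le, hbpm_le, -, -, -, -, -, hdre, hdn, hen⟩ := hcoef w hw
    have hdw := hd_ne w hw
    have hκc : (κ : ℂ) ≠ 0 := Complex.ofReal_ne_zero.2 hκ0.ne'
    -- rewrite `H`
    have hrew : H w = ((a₀ : ℂ) + (Λ : ℂ) / d w) * P w - (bpp w * P w + bpm w * M w + (f₁ w + 3 * f₂ w)) / d w := by
      simp only [hH]; field_simp; ring
    -- the small coefficient
    have hsmall : (a₀ : ℂ) + (Λ : ℂ) / d w = (Λ : ℂ) * (w * e w) / ((κ : ℂ) * d w) := by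
      have h2 := (hfac w (hDball' w hw)).2
      rw [hd0] at h2
      have h3 : w * e w = d w + κ := by rw [← h2]; ring
      rw [h3]; simp only [ha₀]; push_cast; field_simp
    have hsmall_norm : ‖(a₀ : ℂ) + (Λ : ℂ) / d w‖ ≤ 6 * ρ * Λ * Ce / κ ^ 2 := by
      rw [hsmall, norm_div, norm_mul, norm_mul, norm_mul, Complex.norm_real, Complex.norm_real, Real.norm_eq_abs,
        Real.norm_eq_abs, abs_of_pos hΛ0, abs_of_pos hκ0]
      rw [div_le_div_iff₀ (by positivity) (by positivity)]
      have h1 : ‖w‖ * ‖e w‖ ≤ 3 * ρ * Ce := mul_le_mul (hnormD w hw) hen (norm_nonneg _) (by positivity)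
      have h2 : κ ^ 2 ≤ κ * ‖d w‖ * 2 := by nlinarith [hd_norm w hw]
      calc Λ * (‖w‖ * ‖e w‖) * κ ^ 2 ≤ Λ * (3 * ρ * Ce) * (κ * ‖d w‖ * 2) :=
            mul_le_mul (mul_le_mul_of_nonneg_left h1 hΛ0.le) h2 (by positivity) (by positivity)
        _ = 6 * ρ * Λ * Ce * (κ * ‖d w‖) := by ring
    have hsecond : ‖(bpp w * P w + bpm w * M w + (f₁ w + 3 * f₂ w)) / d w‖ ≤ 2 / κ * (Cβ * SP + Cβ * SM + 4 * N) := by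
      rw [norm_div]
      obtain ⟨hf1, hf2⟩ := hresN w hw
      have hnum : ‖bpp w * P w + bpm w * M w + (f₁ w + 3 * f₂ w)‖ ≤ Cβ * SP + Cβ * SM + 4 * N := by
        refine norm_add_le_of_le (norm_add_le_of_le (norm_mul_le_of_le hbpp_le (hP_le w hw) (by linarith))
          (norm_mul_le_of_le hbpm_le (hM_le w hw) (by linarith))) ?_
        calc ‖f₁ w + 3 * f₂ w‖ ≤ ‖f₁ w‖ + ‖(3 : ℂ) * f₂ w‖ := norm_add_le _ _
          _ ≤ 4 * N := by rw [norm_mul]; norm_num; linarith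
      have hpos : 0 ≤ Cβ * SP + Cβ * SM + 4 * N := by positivity
      calc ‖bpp w * P w + bpm w * M w + (f₁ w + 3 * f₂ w)‖ / ‖d w‖ ≤ (Cβ * SP + Cβ * SM + 4 * N) / (κ / 2) := by
            gcongr
            exact hd_norm w hw
        _ = 2 / κ * (Cβ * SP + Cβ * SM + 4 * N) := by field_simp
    rw [hrew]
    refine norm_sub_le_of_le ?_ hsecond
    exact norm_mul_le_of_le hsmall_norm (hP_le w hw) (by positivity)
  have hPbound : ∀ z ∈ D, ‖P z‖ ≤ 6 * ρ * Ce / κ * SP + 2 / Λ * (Cβ * SP + Cβ * SM + 4 * N) := by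
    intro z hz
    have hray : ∀ σ ∈ Icc (0 : ℝ) 1, ‖H ((σ : ℂ) * z)‖ ≤ 6 * ρ * Λ * Ce / κ ^ 2 * SP + 2 / κ * (Cβ * SP + Cβ * SM + 4 * N) := by
      intro σ hσ
      have hmem : (σ : ℂ) * z ∈ D := by
        have h := hDst hz (sub_nonneg.2 hσ.2) hσ.1 (sub_add_cancel 1 σ)
        simpa [Complex.real_smul] using h
      exact hHbound _ hmem
    have key := eulerHolomorphic_apriori_bound a₀ D P H ha₀pos hDo hDst hPdiff hPeq z hz _ hray
    have hconv : (6 * ρ * Λ * Ce / κ ^ 2 * SP + 2 / κ * (Cβ * SP + Cβ * SM + 4 * N)) / a₀ =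
        6 * ρ * Ce / κ * SP + 2 / Λ * (Cβ * SP + Cβ * SM + 4 * N) := by
      simp only [ha₀]; field_simp
    rw [hconv] at key
    exact key
  have hSPle : SP ≤ 6 * ρ * Ce / κ * SP + 2 / Λ * (Cβ * SP + Cβ * SM + 4 * N) :=
    csSup_le hneP (by rintro _ ⟨w, hw, rfl⟩; exact hPbound w hw)
  -- STEP 3: closing the 2×2 system of sup inequalities
  intro z hz
  have hx : Cβ / Λ ≤ 1 / 50 := by rw [div_le_div_iff₀ hΛ0 (by norm_num)]; linarith
  have hρCe : 6 * ρ * Ce / κ ≤ 1 / 4 := by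
    rw [div_le_div_iff₀ hκ0 (by norm_num)]
    have h1 : ρ * (24 * (Ce + 1)) ≤ κ := (le_div_iff₀ (by positivity)).1 hρκ
    nlinarith
  -- products
  have hq1 : 6 * ρ * Ce / κ * SP ≤ SP / 4 := by nlinarith
  have hq2 : Cβ / Λ * SP ≤ SP / 50 := (by nlinarith); have hq3 : Cβ / Λ * SM ≤ SM / 50 := (by nlinarith)
  set ν : ℝ := N / Λ with hν
  have hν0 : 0 ≤ ν := by positivity
  have hSP' : SP ≤ SP / 4 + 2 * (SP / 50) + 2 * (SM / 50) + 8 * ν := by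
    have he : 2 / Λ * (Cβ * SP + Cβ * SM + 4 * N) = 2 * (Cβ / Λ * SP) + 2 * (Cβ / Λ * SM) + 8 * ν := by
      simp only [hν]; field_simp; ring
    linarith [hSPle, he ▸ (le_refl (2 / Λ * (Cβ * SP + Cβ * SM + 4 * N)))]
  have hSM' : SM ≤ 3 * R + 30 * (SP / 50) + 120 * ν := by
    have he : 30 * (Cβ * SP + 4 * N) / Λ = 30 * (Cβ / Λ * SP) + 120 * ν := by
      simp only [hν]; field_simp; ring
    linarith [hSMle, he ▸ (le_refl (30 * (Cβ * SP + 4 * N) / Λ))]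
  have hSMfin : SM ≤ 4 * R + 140 * ν := (by nlinarith); have hSPfin : SP ≤ R + 28 * ν := (by nlinarith)
  -- back to `U₁`, `U₂`
  have hU₁eq : U₁ z = (P z + M z) / 2 := by simp only [hP, hM]; ring
  have hU₂eq : U₂ z = (P z - M z) / 6 := by simp only [hP, hM]; ring
  have h1 : ‖U₁ z‖ ≤ (SP + SM) / 2 := by
    rw [hU₁eq, norm_div]; norm_num
    linarith [norm_add_le (P z) (M z), hP_le z hz, hM_le z hz]
  have h2 : ‖U₂ z‖ ≤ (SP + SM) / 6 := by
    rw [hU₂eq, norm_div]; norm_num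
    linarith [norm_sub_le (P z) (M z), hP_le z hz, hM_le z hz]
  simp only [hν] at hSMfin hSPfin
  nlinarith

end Summit.AtomisticToContinuum.HydrodynamicLimit.Theorems.PackingAnalyticImplosion

end
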